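import Literature.NumberTheory.LFunctions.Zhang2022.ObjectiveTwinDetTwoTerm

/-!
# Zhang (2022) design-space objective, twin part 18b: the §D full-gap EDGE sequence `b = (1, J−½, J+½)` —
# kernel values of the two-term witness `k₁ + (−1)^J k_J` at `J = 2` and `J = 5`

Y. Zhang, *Discrete mean estimates and the Landau–Siegel zero*, arXiv:2211.02515v1 (2022)
[Zhang2022LandauSiegel] — an unrefereed manuscript under adjudication. **This file SEARCHES and TYPES; it
makes no claim about Landau–Siegel zeros, about Theorems 1–2 of the manuscript, or about a repaired (2.32),
until a kernel theorem says so.** LANDAU–SIEGEL programme, cell `landau-siegel`, §A Lean twin serving §D (edge ell,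
card «ell-vernier-far-pair»): ls-Bmulti-num-1 g4 (cell INBOX 2026-08-27T01:20:50Z, kit j264345) found on all 63 EDGE
cells of ls-ref-1's scan the certified negative two-term witness `k₁ ∓ k_J`, with the full-gap straddle values
`−7.17442310645834…` (`J = 5`), `−7.14170150988410…` (`J = 20`), `−7.14159919652982…` (`J = 50`), «apparently
`→ −(4+π)`». With part 18's two-term formula (`Det.formDet_recipe_twoTerm`):

* `Det.formDet_fullGapEdge_two` — `J = 2`: `FormDet (shiftRecipe (1, 3/2, 5/2)) (k₁ + k₂) = −4 − 7π/6`
  (`W = (−4i/3, 3, 5/3)`, `Det.shiftW_fullGap_two`, `moments_fullGap_two`);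
* `Det.formDet_fullGapEdge_five` — `J = 5`: `FormDet (shiftRecipe (1, 9/2, 11/2)) (k₁ − k₅) = −704/175 − 316π/315`
  (`∈ (−7.174424, −7.174423)` ∋ lineage A's value; `W = (4i/63, 9/7, 11/9)`);
* `Det.not_formDetPSD_fullGapEdge_two_five`; `J = 3` is part 16's `formDet_shiftRecipe_edge52_k13` (`−112/27 − 46π/45`).

DESK closed form for every `J ≥ 2` (exact arithmetic with the same formulas, seat folder scratch/fullgap.py; NOT a
theorem here): `F(J) = −4 − π − π/(J(2J−1)(2J−3)) − [J odd]·4/(J²(2J−3))`, so `F(J) → −(4+π)`; the three kernel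
values `J = 2, 3, 5` agree with it. SCOPE: `b₀ = 1` is the INADMISSIBLE edge (zero near-detuning) — engine-certification
values, not statements about admissible designs. Theorems only; no new definitions.
-/

noncomputable section

open Complex Real ComplexConjugate

namespace Literature.NumberTheory.LFunctions.Zhang2022

namespace Det

open Repair Objective

/-! ## Helpers -/

/-- `x / c_j = x·(1/(jπ))·i` (`c_j = −iπj`). [folklore] -/
private theorem div_afeFreq₁₈ (x : ℂ) {j : ℕ} (hj : j ≠ 0) :
    x / afeFreq j = x * (((1 / (j * π)) : ℝ) : ℂ) * Complex.I := by
  have hc := afeFreq_ne_zero hj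
  rw [div_eq_iff hc]
  unfold afeFreq
  push_cast
  have hπ : (π : ℂ) ≠ 0 := Complex.ofReal_ne_zero.mpr Real.pi_ne_zero
  have hjc : (j : ℂ) ≠ 0 := Nat.cast_ne_zero.mpr hj
  field_simp
  ring_nf
  rw [Complex.I_sq]
  ring

/-- `1/c_j = (1/(jπ))·i`. [folklore] -/
private theorem afeFreq_inv₁₈ {j : ℕ} (hj : j ≠ 0) :
    (afeFreq j)⁻¹ = (((1 / (j * π)) : ℝ) : ℂ) * Complex.I := by
  rw [inv_eq_one_div, div_afeFreq₁₈ 1 hj, one_mul]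

/-- `c_j = −(jπ)·i`. [folklore] -/
private theorem afeFreq_eq₁₈ (j : ℕ) : afeFreq j = ((-(j * π) : ℝ) : ℂ) * Complex.I := by
  unfold afeFreq; push_cast; ring

/-- `‖z‖² = Re² + Im²`. [folklore] -/
private theorem normSq_re_im₁₈ (z : ℂ) : ‖z‖ ^ 2 = z.re ^ 2 + z.im ^ 2 := by
  rw [Complex.sq_norm, Complex.normSq_apply]; ring

/-- `s(1, 3/2, 5/2) = (4, 7/2, 5/2)`. [cite: Zhang2022LandauSiegel, §8 (8.13)–(8.18)] -/
theorem shiftS_fullGap_two : shiftS ![1, 3 / 2, 5 / 2] = ![4, 7 / 2, 5 / 2] := by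
  funext j; fin_cases j <;> (simp [shiftS]; try norm_num)

/-- `n(1, 3/2, 5/2) = (15/4, 5/2, 3/2)`. [cite: Zhang2022LandauSiegel, §8 (8.13)–(8.18)] -/
theorem shiftN_fullGap_two : shiftN ![1, 3 / 2, 5 / 2] = ![15 / 4, 5 / 2, 3 / 2] := by
  funext j; fin_cases j <;> (simp [shiftN]; try norm_num)

/-- `W(1, 3/2, 5/2) = (−4i/3, 3, 5/3)` (phases `e^{3πi/2} = −i`, `e^{iπ} = −1`, `1`; `v = (3/4, −1/2, 3/2)`).
[cite: Zhang2022LandauSiegel, proof of Prop 7.1, (7.19)–(7.21)] -/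
theorem shiftW_fullGap_two : shiftW ![1, 3 / 2, 5 / 2] = ![-(4 / 3 : ℂ) * I, 3, 5 / 3] := by
  funext j
  fin_cases j
  · simp only [shiftW, shiftS, shiftVdm]
    simp only [Fin.zero_eta, Fin.isValue, Matrix.cons_val_zero, Matrix.cons_val_one, Matrix.head_cons,
      Matrix.cons_val_two, Matrix.tail_cons]
    have h : cexp (I * π * (((3 / 2 + 5 / 2 - 1) / 2 : ℝ) : ℂ)) = -I := by
      rw [show (((3 / 2 + 5 / 2 - 1) / 2 : ℝ) : ℂ) = 3 / 2 by push_cast; norm_num,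
        show I * π * (3 / 2) = (π / 2 : ℂ) * I + π * I by ring, Complex.exp_add, Complex.exp_pi_mul_I,
        Complex.exp_mul_I, Complex.cos_pi_div_two, Complex.sin_pi_div_two]
      simp
    rw [h]; push_cast; field_simp; ring_nf; try norm_num
  · simp only [shiftW, shiftS, shiftVdm]
    simp only [Fin.mk_one, Fin.isValue, Matrix.cons_val_zero, Matrix.cons_val_one, Matrix.head_cons,
      Matrix.cons_val_two, Matrix.tail_cons]
    have h : cexp (I * π * (((5 / 2 + 1 - 3 / 2) / 2 : ℝ) : ℂ)) = -1 := by
      rw [show (((5 / 2 + 1 - 3 / 2) / 2 : ℝ) : ℂ) = 1 by push_cast; norm_num,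
        show I * π * 1 = π * I by ring, Complex.exp_pi_mul_I]
    rw [h]; push_cast; norm_num
  · simp only [shiftW, shiftS, shiftVdm]
    simp only [Fin.reduceFinMk, Fin.isValue, Matrix.cons_val_zero, Matrix.cons_val_one, Matrix.head_cons,
      Matrix.cons_val_two, Matrix.tail_cons]
    have h : cexp (I * π * (((1 + 3 / 2 - 5 / 2) / 2 : ℝ) : ℂ)) = 1 := by
      rw [show (((1 + 3 / 2 - 5 / 2) / 2 : ℝ) : ℂ) = 0 by push_cast; norm_num, mul_zero, Complex.exp_zero]
    rw [h]; push_cast; norm_num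

/-- Moments of `shiftRecipe (1, 3/2, 5/2)`: `(14/3 − 4i/3, 44/3 − 16i/3, 10 − 5i, 26/3 − 4i/3, 157/6 − 16i/3, 35/2 − 5i)`.
[cite: Zhang2022LandauSiegel, Prop 7.1 p.44, (8.11)–(8.23)] -/
theorem moments_fullGap_two :
    (∑ j : Fin 3, (shiftRecipe ![1, 3 / 2, 5 / 2]).W j) = 14 / 3 - 4 / 3 * I ∧
    (∑ j : Fin 3, (shiftRecipe ![1, 3 / 2, 5 / 2]).W j * ((shiftRecipe ![1, 3 / 2, 5 / 2]).s j : ℂ)) = 44 / 3 - 16 / 3 * I ∧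
    (∑ j : Fin 3, (shiftRecipe ![1, 3 / 2, 5 / 2]).W j * ((shiftRecipe ![1, 3 / 2, 5 / 2]).n j : ℂ)) = 10 - 5 * I ∧
    (∑ j : Fin 3, (shiftRecipe ![1, 3 / 2, 5 / 2]).W j * ((shiftRecipe ![1, 3 / 2, 5 / 2]).b j : ℂ)) = 26 / 3 - 4 / 3 * I ∧
    (∑ j : Fin 3, (shiftRecipe ![1, 3 / 2, 5 / 2]).W j *
        (((shiftRecipe ![1, 3 / 2, 5 / 2]).b j : ℂ) * ((shiftRecipe ![1, 3 / 2, 5 / 2]).s j : ℂ))) = 157 / 6 - 16 / 3 * I ∧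
    (∑ j : Fin 3, (shiftRecipe ![1, 3 / 2, 5 / 2]).W j *
        (((shiftRecipe ![1, 3 / 2, 5 / 2]).b j : ℂ) * ((shiftRecipe ![1, 3 / 2, 5 / 2]).n j : ℂ))) = 35 / 2 - 5 * I := by
  simp only [shiftRecipe, shiftW_fullGap_two, shiftS_fullGap_two, shiftN_fullGap_two, Fin.sum_univ_three]
  simp only [Fin.isValue, Matrix.cons_val_zero, Matrix.cons_val_one, Matrix.head_cons, Matrix.cons_val_two,
    Matrix.tail_cons]
  push_cast
  refine ⟨by ring, by ring, by ring, by ring, by ring, by ring⟩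

/-- **`J = 2` of the edge sequence**: `FormDet (shiftRecipe (1, 3/2, 5/2)) (k₁ + k₂) = −4 − 7π/6` (the witness is the
kernel mode `g⋆ = k₁ + k₂`; value via the two-term formula with `p = 1, q = 2`).
[cite: Zhang2022LandauSiegel, Prop 7.1 p.44 with (8.11)–(8.23); §2 (2.13)] -/
theorem formDet_fullGapEdge_two :
    FormDet (shiftRecipe ![1, 3 / 2, 5 / 2]) (fun y => (1:ℂ) * afeDir 1 y + 1 * afeDir 2 y)
        (fun y => (1:ℂ) * afeDir' 1 y + 1 * afeDir' 2 y) = -4 - 7 * π / 6 := by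
  obtain ⟨h0, hs, hn, hb, hbs, hbn⟩ := moments_fullGap_two
  rw [formDet_recipe_twoTerm _ one_ne_zero (by norm_num : 1 < 2) 1 1 (by norm_num), h0, hs, hn, hb, hbs, hbn]
  simp only [show (2:ℕ) - 1 = 1 from rfl, div_eq_mul_inv, afeFreq_inv₁₈ one_ne_zero, afeFreq_inv₁₈ two_ne_zero]
  simp only [afeFreq_eq₁₈]
  have hπ : π ≠ 0 := Real.pi_ne_zero
  simp only [map_add, map_mul, map_sub, map_neg, map_one, Complex.conj_ofReal, Complex.conj_I,
    Complex.add_re, Complex.add_im, Complex.sub_re, Complex.sub_im, Complex.mul_re, Complex.mul_im,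
    Complex.neg_re, Complex.neg_im, Complex.I_re, Complex.I_im, Complex.ofReal_re, Complex.ofReal_im,
    Complex.one_re, Complex.one_im, Complex.re_ofNat, Complex.im_ofNat]
  push_cast
  field_simp
  norm_num
  ring

/-- Kernel bracket `−4 − 7π/6 ∈ (−7.6652, −7.66519)`. [cite: Zhang2022LandauSiegel, Prop 7.1 p.44; §2 (2.13)] -/
theorem formDet_fullGapEdge_two_bounds : (-7.6652 : ℝ) < -4 - 7 * π / 6 ∧ -4 - 7 * π / 6 < -7.66519 := by
  have h1 := Real.pi_gt_d20
  have h2 := Real.pi_lt_d20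
  constructor <;> linarith

/-- `s(1, 9/2, 11/2) = (10, 13/2, 11/2)`. [cite: Zhang2022LandauSiegel, §8 (8.13)–(8.18)] -/
theorem shiftS_fullGap_five : shiftS ![1, 9 / 2, 11 / 2] = ![10, 13 / 2, 11 / 2] := by
  funext j; fin_cases j <;> (simp [shiftS]; try norm_num)

/-- `n(1, 9/2, 11/2) = (99/4, 11/2, 9/2)`. [cite: Zhang2022LandauSiegel, §8 (8.13)–(8.18)] -/
theorem shiftN_fullGap_five : shiftN ![1, 9 / 2, 11 / 2] = ![99 / 4, 11 / 2, 9 / 2] := by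
  funext j; fin_cases j <;> (simp [shiftN]; try norm_num)

/-- `W(1, 9/2, 11/2) = (4i/63, 9/7, 11/9)` (phases `e^{9πi/2} = i`, `e^{iπ} = −1`, `1`; `v = (63/4, −7/2, 9/2)`).
[cite: Zhang2022LandauSiegel, proof of Prop 7.1, (7.19)–(7.21)] -/
theorem shiftW_fullGap_five : shiftW ![1, 9 / 2, 11 / 2] = ![(4 / 63 : ℂ) * I, 9 / 7, 11 / 9] := by
  funext j
  fin_cases j
  · simp only [shiftW, shiftS, shiftVdm]
    simp only [Fin.zero_eta, Fin.isValue, Matrix.cons_val_zero, Matrix.cons_val_one, Matrix.head_cons,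
      Matrix.cons_val_two, Matrix.tail_cons]
    have h : cexp (I * π * (((9 / 2 + 11 / 2 - 1) / 2 : ℝ) : ℂ)) = I := by
      rw [show (((9 / 2 + 11 / 2 - 1) / 2 : ℝ) : ℂ) = 9 / 2 by push_cast; norm_num,
        show I * π * (9 / 2) = (π / 2 : ℂ) * I + ((2:ℕ) : ℂ) * (2 * π * I) by push_cast; ring, Complex.exp_add,
        Complex.exp_nat_mul, Complex.exp_two_pi_mul_I, one_pow, mul_one,
        Complex.exp_mul_I, Complex.cos_pi_div_two, Complex.sin_pi_div_two]
      simp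
    rw [h]; push_cast; field_simp; ring_nf; try norm_num
  · simp only [shiftW, shiftS, shiftVdm]
    simp only [Fin.mk_one, Fin.isValue, Matrix.cons_val_zero, Matrix.cons_val_one, Matrix.head_cons,
      Matrix.cons_val_two, Matrix.tail_cons]
    have h : cexp (I * π * (((11 / 2 + 1 - 9 / 2) / 2 : ℝ) : ℂ)) = -1 := by
      rw [show (((11 / 2 + 1 - 9 / 2) / 2 : ℝ) : ℂ) = 1 by push_cast; norm_num,
        show I * π * 1 = π * I by ring, Complex.exp_pi_mul_I]
    rw [h]; push_cast; norm_num
  · simp only [shiftW, shiftS, shiftVdm]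
    simp only [Fin.reduceFinMk, Fin.isValue, Matrix.cons_val_zero, Matrix.cons_val_one, Matrix.head_cons,
      Matrix.cons_val_two, Matrix.tail_cons]
    have h : cexp (I * π * (((1 + 9 / 2 - 11 / 2) / 2 : ℝ) : ℂ)) = 1 := by
      rw [show (((1 + 9 / 2 - 11 / 2) / 2 : ℝ) : ℂ) = 0 by push_cast; norm_num, mul_zero, Complex.exp_zero]
    rw [h]; push_cast; norm_num

/-- Moments of `shiftRecipe (1, 9/2, 11/2)`:
`(158/63 + 4i/63, 950/63 + 40i/63, 88/7 + 11i/7, 788/63 + 4i/63, 9397/126 + 40i/63, 869/14 + 11i/7)`.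
[cite: Zhang2022LandauSiegel, Prop 7.1 p.44, (8.11)–(8.23)] -/
theorem moments_fullGap_five :
    (∑ j : Fin 3, (shiftRecipe ![1, 9 / 2, 11 / 2]).W j) = 158 / 63 + 4 / 63 * I ∧
    (∑ j : Fin 3, (shiftRecipe ![1, 9 / 2, 11 / 2]).W j * ((shiftRecipe ![1, 9 / 2, 11 / 2]).s j : ℂ))
      = 950 / 63 + 40 / 63 * I ∧
    (∑ j : Fin 3, (shiftRecipe ![1, 9 / 2, 11 / 2]).W j * ((shiftRecipe ![1, 9 / 2, 11 / 2]).n j : ℂ))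
      = 88 / 7 + 11 / 7 * I ∧
    (∑ j : Fin 3, (shiftRecipe ![1, 9 / 2, 11 / 2]).W j * ((shiftRecipe ![1, 9 / 2, 11 / 2]).b j : ℂ))
      = 788 / 63 + 4 / 63 * I ∧
    (∑ j : Fin 3, (shiftRecipe ![1, 9 / 2, 11 / 2]).W j *
        (((shiftRecipe ![1, 9 / 2, 11 / 2]).b j : ℂ) * ((shiftRecipe ![1, 9 / 2, 11 / 2]).s j : ℂ)))
      = 9397 / 126 + 40 / 63 * I ∧
    (∑ j : Fin 3, (shiftRecipe ![1, 9 / 2, 11 / 2]).W j *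
        (((shiftRecipe ![1, 9 / 2, 11 / 2]).b j : ℂ) * ((shiftRecipe ![1, 9 / 2, 11 / 2]).n j : ℂ)))
      = 869 / 14 + 11 / 7 * I := by
  simp only [shiftRecipe, shiftW_fullGap_five, shiftS_fullGap_five, shiftN_fullGap_five, Fin.sum_univ_three]
  simp only [Fin.isValue, Matrix.cons_val_zero, Matrix.cons_val_one, Matrix.head_cons, Matrix.cons_val_two,
    Matrix.tail_cons]
  push_cast
  refine ⟨by ring, by ring, by ring, by ring, by ring, by ring⟩

/-- **`J = 5` of the edge sequence**: `FormDet (shiftRecipe (1, 9/2, 11/2)) (k₁ − k₅) = −704/175 − 316π/315`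
(`≈ −7.17442`, lineage A's certified `[−7.17442310645834, …833]` ✓; `p = 1`, `q = 5`, `x = 1`, `z = −1`).
[cite: Zhang2022LandauSiegel, Prop 7.1 p.44 with (8.11)–(8.23); §2 (2.13)] -/
theorem formDet_fullGapEdge_five :
    FormDet (shiftRecipe ![1, 9 / 2, 11 / 2]) (fun y => (1:ℂ) * afeDir 1 y + (-1) * afeDir 5 y)
        (fun y => (1:ℂ) * afeDir' 1 y + (-1) * afeDir' 5 y) = -(704 / 175) - 316 * π / 315 := by
  obtain ⟨h0, hs, hn, hb, hbs, hbn⟩ := moments_fullGap_five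
  rw [formDet_recipe_twoTerm _ one_ne_zero (by norm_num : 1 < 5) 1 (-1) (by norm_num), h0, hs, hn, hb, hbs, hbn]
  simp only [show (5:ℕ) - 1 = 4 from rfl, div_eq_mul_inv, afeFreq_inv₁₈ one_ne_zero,
    afeFreq_inv₁₈ (by norm_num : (5:ℕ) ≠ 0), afeFreq_inv₁₈ (by norm_num : (4:ℕ) ≠ 0)]
  simp only [afeFreq_eq₁₈]
  have hπ : π ≠ 0 := Real.pi_ne_zero
  simp only [map_add, map_mul, map_sub, map_neg, map_one, Complex.conj_ofReal, Complex.conj_I,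
    Complex.add_re, Complex.add_im, Complex.sub_re, Complex.sub_im, Complex.mul_re, Complex.mul_im,
    Complex.neg_re, Complex.neg_im, Complex.I_re, Complex.I_im, Complex.ofReal_re, Complex.ofReal_im,
    Complex.one_re, Complex.one_im, Complex.re_ofNat, Complex.im_ofNat]
  push_cast
  field_simp
  norm_num
  ring

/-- Kernel bracket `−704/175 − 316π/315 ∈ (−7.174424, −7.174423)`. [cite: Zhang2022LandauSiegel, Prop 7.1 p.44; §2 (2.13)] -/
theorem formDet_fullGapEdge_five_bounds :
    (-7.174424 : ℝ) < -(704 / 175) - 316 * π / 315 ∧ -(704 / 175) - 316 * π / 315 < -7.174423 := by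
  have h1 := Real.pi_gt_d20
  have h2 := Real.pi_lt_d20
  constructor <;> linarith

/-- Neither edge recipe is PSD in formula I on one-sided kinked profiles (inadmissible `b₀ = 1`; witnesses above).
[cite: Zhang2022LandauSiegel, Prop 7.1 p.44; §2 (2.13)] -/
theorem not_formDetPSD_fullGapEdge_two_five :
    ¬ FormDetPSD (shiftRecipe ![1, 3 / 2, 5 / 2]) ∧ ¬ FormDetPSD (shiftRecipe ![1, 9 / 2, 11 / 2]) := by
  constructor
  · intro h
    have hu1 : (fun y : ℝ => (1:ℂ) * afeDir 1 y + 1 * afeDir 2 y) 1 = 0 := by simp only [afeDir_one]; norm_num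
    have hv := h _ _ (kinkedProfile_twoTerm 1 2 1 1) hu1
    rw [formDet_fullGapEdge_two] at hv
    linarith [formDet_fullGapEdge_two_bounds.2]
  · intro h
    have hu1 : (fun y : ℝ => (1:ℂ) * afeDir 1 y + (-1) * afeDir 5 y) 1 = 0 := by simp only [afeDir_one]; norm_num
    have hv := h _ _ (kinkedProfile_twoTerm 1 5 1 (-1)) hu1
    rw [formDet_fullGapEdge_five] at hv
    linarith [formDet_fullGapEdge_five_bounds.2]

end Det

end Literature.NumberTheory.LFunctions.Zhang2022
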